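import Summits.Ventures.PercRepro.GenQHypAddTwo

/-!
# PercRepro — C-025 at `(q + 2, q)`: «hyperplane + two points» at the top type recurses to the top type one level
down, part B — the demand and the recursion theorem (night-4, gen 0; part A = `GenQHypAddTwo.lean`)

With the supply bound `supply_ge_two_mul` of part A (`Σ_{R_q(τ)} 4·w_∞ ≤ Σ_{R_{q+1}(G)} 2·w_∞` for
`G = τ ∪ {a, a′}`, `a, a′ ∉ cl(τ)`, `ρ(G) = q + 1`):

* `demand_case` / `demand_subset_images`: a demanding rank-`(q + 1)` subset of `G` at the top type contains exactly
  one of `a, a′`, and removing it leaves a demanding rank-`q` subset of `τ` at ITS top type — so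
  `#U_{q+1}(G) ≤ 2·#U_q(τ)` (`card_demand_le_two_mul`);
* `phiK_succ_succ_antitone`: `(q + 3)/(q + 2) ≤ (q + 2)/(q + 1)`;
* **`two_mul_Jq_le_Jq_hyp_add_two`**: `2 · Jq M τ q q ≤ Jq M (τ ∪ {a, a′}) (q + 1) (q + 1)` — the top-type balance
  of a «hyperplane + two points» set at level `q + 1` follows from the top-type balance of its hyperplane trace at
  level `q`.  `PlaneAddTwoFour` (p1's tables at `(6, 4)`) is the case `q = 3`: it follows from the per-plane balance
  of the `(5, 3)` row at its top type.
-/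

namespace PercRepro.GenQ

open Finset ThmH SixFour

variable {α : Type*} [DecidableEq α] {M : Matroid α} [M.Finite]

section HypAddTwoB

variable {τ : Finset α} {a a' : α} {q : ℕ}

/-- **One demanding set, one point removed**: if `x ∈ B`, `y ∉ B`, `G = τ ∪ {x, y}` with `x, y ∉ τ`, and `B` is a
demanding rank-`(q + 1)` subset of `G` at the top type, then `B ∖ {x}` is a demanding rank-`q` subset of `τ` at its
top type. -/
theorem demand_case {x y : α} {B : Finset α} (hrτ : M.eRk (τ : Set α) = (q : ℕ∞))
    (hx : x ∈ B) (hy : y ∉ B) (hBG : B ⊆ insert x (insert y τ))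
    (hrB : M.eRk (B : Set α) = ((q + 1 : ℕ) : ℕ∞))
    (hd : ¬ (M.eRk ((insert x (insert y τ) \ B : Finset α) : Set α) + 1 ≤ ((q + 1 : ℕ) : ℕ∞))) :
    B.erase x ∈ (Rq M τ q).filter (fun C => ¬ (M.eRk ((τ \ C : Finset α) : Set α) + 1 ≤ (q : ℕ∞))) ∧
      B = insert x (B.erase x) := by
  refine ⟨?_, (Finset.insert_erase hx).symm⟩
  have hsub : B.erase x ⊆ τ := by
    intro z hz
    rw [Finset.mem_erase] at hz
    have := hBG hz.2
    rw [Finset.mem_insert, Finset.mem_insert] at this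
    rcases this with h | h | h
    · exact absurd h hz.1
    · exact absurd (h ▸ hz.2) hy
    · exact h
  -- `ρ(B ∖ {x}) = q`
  have hr1 : M.eRk ((B.erase x : Finset α) : Set α) = (q : ℕ∞) := by
    apply le_antisymm
    · rw [← hrτ]
      exact M.eRk_mono (Finset.coe_subset.2 hsub)
    · have h := M.eRk_insert_le_add_one x ((B.erase x : Finset α) : Set α)
      rw [← Finset.coe_insert, Finset.insert_erase hx, hrB] at h
      obtain ⟨k, hk, -⟩ := eRk_eq_nat M (B.erase x)
      rw [hk] at h ⊢
      have h' : ((q + 1 : ℕ) : ℕ∞) ≤ ((k + 1 : ℕ) : ℕ∞) := by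
        push_cast
        exact h
      have := (Nat.cast_le (α := ℕ∞)).1 h'
      exact_mod_cast (by omega : q ≤ k)
  -- the complement in `τ` still has rank `q`
  have hcomp : insert x (insert y τ) \ B ⊆ insert y (τ \ B.erase x) := by
    intro z hz
    rw [Finset.mem_sdiff, Finset.mem_insert, Finset.mem_insert] at hz
    rw [Finset.mem_insert, Finset.mem_sdiff, Finset.mem_erase]
    rcases hz.1 with h | h | h
    · exact absurd (h ▸ hx) hz.2
    · exact Or.inl h
    · exact Or.inr ⟨h, fun hh => hz.2 hh.2⟩
  rw [Finset.mem_filter, mem_Rq]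
  refine ⟨⟨hsub, hr1⟩, ?_⟩
  intro hle
  apply hd
  have h1 : M.eRk ((insert x (insert y τ) \ B : Finset α) : Set α) ≤
      M.eRk ((insert y (τ \ B.erase x) : Finset α) : Set α) := M.eRk_mono (Finset.coe_subset.2 hcomp)
  have h2 := M.eRk_insert_le_add_one y ((τ \ B.erase x : Finset α) : Set α)
  rw [← Finset.coe_insert] at h2
  calc M.eRk ((insert x (insert y τ) \ B : Finset α) : Set α) + 1
      ≤ M.eRk ((τ \ B.erase x : Finset α) : Set α) + 1 + 1 := by
        gcongr
        exact h1.trans h2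
    _ ≤ (q : ℕ∞) + 1 := by gcongr
    _ = ((q + 1 : ℕ) : ℕ∞) := by push_cast; rfl

/-- **Demand**: the demanding rank-`(q + 1)` subsets of `G = τ ∪ {a, a′}` at the top type lie in the images of the
demanding rank-`q` subsets of `τ` under `B″ ↦ B″ ∪ {a}` and `B″ ↦ B″ ∪ {a′}`. -/
theorem demand_subset_images (hrτ : M.eRk (τ : Set α) = (q : ℕ∞)) :
    (Rq M (insert a (insert a' τ)) (q + 1)).filter
        (fun B => ¬ (M.eRk ((insert a (insert a' τ) \ B : Finset α) : Set α) + 1 ≤ ((q + 1 : ℕ) : ℕ∞))) ⊆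
      ((Rq M τ q).filter (fun C => ¬ (M.eRk ((τ \ C : Finset α) : Set α) + 1 ≤ (q : ℕ∞)))).image
          (fun C => insert a C) ∪
        ((Rq M τ q).filter (fun C => ¬ (M.eRk ((τ \ C : Finset α) : Set α) + 1 ≤ (q : ℕ∞)))).image
          (fun C => insert a' C) := by
  intro B hB
  rw [Finset.mem_filter, mem_Rq] at hB
  obtain ⟨⟨hBG, hrB⟩, hd⟩ := hB
  rw [Finset.mem_union, Finset.mem_image, Finset.mem_image]
  by_cases hxa : a ∈ B
  · by_cases hxa' : a' ∈ B
    · -- both points in `B`: the complement lies in `τ`, rank `≤ q`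
      exfalso
      apply hd
      have hsub : insert a (insert a' τ) \ B ⊆ τ := by
        intro z hz
        rw [Finset.mem_sdiff, Finset.mem_insert, Finset.mem_insert] at hz
        rcases hz.1 with h | h | h
        · exact absurd (h ▸ hxa) hz.2
        · exact absurd (h ▸ hxa') hz.2
        · exact h
      calc M.eRk ((insert a (insert a' τ) \ B : Finset α) : Set α) + 1
          ≤ M.eRk (τ : Set α) + 1 := by
            gcongr
            exact M.eRk_mono (Finset.coe_subset.2 hsub)
        _ = ((q + 1 : ℕ) : ℕ∞) := by rw [hrτ]; push_cast; rfl
    · left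
      obtain ⟨hmem, heq⟩ := demand_case hrτ hxa hxa' hBG hrB hd
      exact ⟨B.erase a, hmem, heq.symm⟩
  · by_cases hxa' : a' ∈ B
    · right
      have hBG' : B ⊆ insert a' (insert a τ) := by
        rw [Finset.insert_comm]
        exact hBG
      have hd' : ¬ (M.eRk ((insert a' (insert a τ) \ B : Finset α) : Set α) + 1 ≤ ((q + 1 : ℕ) : ℕ∞)) := by
        rw [Finset.insert_comm]
        exact hd
      obtain ⟨hmem, heq⟩ := demand_case hrτ hxa' hxa hBG' hrB hd'
      exact ⟨B.erase a', hmem, heq.symm⟩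
    · -- neither point in `B`: `B ⊆ τ` has rank `≤ q`
      exfalso
      have hsub : B ⊆ τ := by
        intro z hz
        have := hBG hz
        rw [Finset.mem_insert, Finset.mem_insert] at this
        rcases this with h | h | h
        · exact absurd (h ▸ hz) hxa
        · exact absurd (h ▸ hz) hxa'
        · exact h
      have h := M.eRk_mono (Finset.coe_subset.2 hsub)
      rw [hrB, hrτ] at h
      have h' := (Nat.cast_le (α := ℕ∞)).1 h
      omega

/-- `#U_{q+1}(G) ≤ 2 · #U_q(τ)`. -/
theorem card_demand_le_two_mul (hrτ : M.eRk (τ : Set α) = (q : ℕ∞)) :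
    ((Rq M (insert a (insert a' τ)) (q + 1)).filter
        (fun B => ¬ (M.eRk ((insert a (insert a' τ) \ B : Finset α) : Set α) + 1 ≤ ((q + 1 : ℕ) : ℕ∞)))).card ≤
      2 * ((Rq M τ q).filter (fun C => ¬ (M.eRk ((τ \ C : Finset α) : Set α) + 1 ≤ (q : ℕ∞)))).card := by
  refine (Finset.card_le_card (demand_subset_images hrτ)).trans ?_
  refine (Finset.card_union_le _ _).trans ?_
  have h1 := Finset.card_image_le (s := (Rq M τ q).filter
    (fun C => ¬ (M.eRk ((τ \ C : Finset α) : Set α) + 1 ≤ (q : ℕ∞)))) (f := fun C => insert a C)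
  have h2 := Finset.card_image_le (s := (Rq M τ q).filter
    (fun C => ¬ (M.eRk ((τ \ C : Finset α) : Set α) + 1 ≤ (q : ℕ∞)))) (f := fun C => insert a' C)
  omega

/-- `Φ(q + 3, q + 1) ≤ Φ(q + 2, q)`: `(q + 3)/(q + 2) ≤ (q + 2)/(q + 1)`. -/
theorem phiK_succ_succ_antitone (q : ℕ) :
    (((q + 1 : ℕ) : ℚ) + 2) / (((q + 1 : ℕ) : ℚ) + 1) ≤ ((q : ℚ) + 2) / ((q : ℚ) + 1) := by
  push_cast
  rw [div_le_div_iff₀ (by positivity) (by positivity)]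
  nlinarith

/-- **The recursion**: `2 · Jq M τ q q ≤ Jq M (τ ∪ {a, a′}) (q + 1) (q + 1)` for `a, a′ ∉ cl(τ)` with
`ρ(τ ∪ {a, a′}) = q + 1` — the top-type balance of a «hyperplane + two points» set at level `q + 1` follows from
the top-type balance of its hyperplane trace at level `q`. -/
theorem two_mul_Jq_le_Jq_hyp_add_two (hG : τ ⊆ gr M) (ha : a ∈ gr M) (ha' : a' ∈ gr M) (hne : a ≠ a')
    (haτ : a ∉ τ) (ha'τ : a' ∉ τ) (hacl : a ∉ M.closure (τ : Set α)) (ha'cl : a' ∉ M.closure (τ : Set α))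
    (hrτ : M.eRk (τ : Set α) = (q : ℕ∞))
    (hrG : M.eRk ((insert a (insert a' τ) : Finset α) : Set α) = (q : ℕ∞) + 1) :
    2 * Jq M τ q q ≤ Jq M (insert a (insert a' τ)) (q + 1) (q + 1) := by
  have hsupply := supply_ge_two_mul hG ha ha' hne haτ ha'τ hacl ha'cl hrG
  have hdemand := card_demand_le_two_mul (M := M) (a := a) (a' := a') hrτ
  have hΦ := phiK_succ_succ_antitone q
  unfold Jq
  rw [Nq_sub_DFq, Nq_sub_DFq]
  have e1 : ∑ B ∈ Rq M τ q, ((q : ℚ) + 2 - (q : ℕ)) * wInf M B = ∑ B ∈ Rq M τ q, 2 * wInf M B := by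
    apply Finset.sum_congr rfl
    intro B _
    ring
  have e2 : ∑ B ∈ Rq M (insert a (insert a' τ)) (q + 1), (((q + 1 : ℕ) : ℚ) + 2 - ((q + 1 : ℕ) : ℚ)) * wInf M B =
      ∑ B ∈ Rq M (insert a (insert a' τ)) (q + 1), 2 * wInf M B := by
    apply Finset.sum_congr rfl
    intro B _
    ring
  rw [e1, e2]
  have e3 : ∑ B ∈ Rq M τ q, 4 * wInf M B = 2 * ∑ B ∈ Rq M τ q, 2 * wInf M B := by
    rw [Finset.mul_sum]
    apply Finset.sum_congr rfl
    intro B _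
    ring
  rw [e3] at hsupply
  set Uτ := ((Rq M τ q).filter (fun C => ¬ (M.eRk ((τ \ C : Finset α) : Set α) + 1 ≤ (q : ℕ∞)))).card with hUτ
  set UG := ((Rq M (insert a (insert a' τ)) (q + 1)).filter
    (fun B => ¬ (M.eRk ((insert a (insert a' τ) \ B : Finset α) : Set α) + 1 ≤ ((q + 1 : ℕ) : ℕ∞)))).card with hUG
  have hd' : (UG : ℚ) ≤ 2 * (Uτ : ℚ) := by exact_mod_cast hdemand
  have hΦ0 : (0 : ℚ) ≤ (((q + 1 : ℕ) : ℚ) + 2) / (((q + 1 : ℕ) : ℚ) + 1) := by positivity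
  have hU0 : (0 : ℚ) ≤ Uτ := by positivity
  have hstep : (((q + 1 : ℕ) : ℚ) + 2) / (((q + 1 : ℕ) : ℚ) + 1) * (UG : ℚ) ≤
      2 * (((q : ℚ) + 2) / ((q : ℚ) + 1) * (Uτ : ℚ)) := by
    calc (((q + 1 : ℕ) : ℚ) + 2) / (((q + 1 : ℕ) : ℚ) + 1) * (UG : ℚ)
        ≤ (((q + 1 : ℕ) : ℚ) + 2) / (((q + 1 : ℕ) : ℚ) + 1) * (2 * (Uτ : ℚ)) :=
          mul_le_mul_of_nonneg_left hd' hΦ0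
      _ ≤ ((q : ℚ) + 2) / ((q : ℚ) + 1) * (2 * (Uτ : ℚ)) :=
          mul_le_mul_of_nonneg_right hΦ (by positivity)
      _ = 2 * (((q : ℚ) + 2) / ((q : ℚ) + 1) * (Uτ : ℚ)) := by ring
  linarith

end HypAddTwoB

end PercRepro.GenQ
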